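import Summits.CriticalPhenomena.PercolationContinuityZ3.Theses.PercLevyKhintchine
import Literature.Analysis.Matrix.SchoenbergKernelsProofs

/-!
# Birth skeleton (BC3) for the crux `LogConnNegType` (stmt-CriticalPhenomena-2166)

Route `route-CriticalPhenomena-PercLevyKhintchine` (sub-problem `PercolationContinuityZ3`), crux decl
`Summit.CriticalPhenomena.PercolationContinuityZ3.Theses.PercLevyKhintchine.LogConnNegType` (rank 2, (ID)):
for every `p ∈ [0,1]` the connectivity logarithm `ψ_p(x,y) = −log τ_p(x,y)` of nearest-neighbour bond
percolation on `ℤ³` is conditionally negative definite —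
`∑ c = 0 ⇒ 0 ≤ ∑_{i,j} c_i c_j log τ_p(x_i,x_j)`.

THE LINE (finite volume first, then `Λ ↑ ℤ³` — the reduction the route review names as the missing glue
"2170 ⟹ r2 by translation + Q ↑ ℤ³", typed translation-free on CENTRED cubes). Two registered stubs:

* STUB 1 `stub_cubeLogConnNegType` (OPEN — LOAD-BEARING; decidable instance by instance): for every `p`,
  every centred cube `Λ_L = box 3 L = {−L,…,L}³` and every finite family of sites of `Λ_L` with real
  weights summing to `0`, `0 ≤ ∑ c_i c_j log P_p(x_i ↔ x_j in Λ_L)` — the free-boundary, finite-volume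
  form of (ID) on cubes (each instance `(p ∈ ℚ, L, family)` is a finite exact computation; it is the
  cube case `a₁ = a₂ = a₃ = 2L` of the route's support item `CuboidLogConnNegType` (stmt-2170) after the
  translation `x ↦ x + (L,L,L)`; evidence 0/616 violations on cuboids up to `3×3×3 = Λ_1` incl.
  `p ≈ p_c(ℤ³)`, EVIDENCE_2170_negtype.md). Deliberately NOT stated for arbitrary finite vertex sets:
  on theta-shaped induced subgraphs (two hubs joined by three disjoint paths of length `ℓ`) the test
  vector `(a, a, −2a/3, −2a/3, −2a/3)` on {hubs, midpoints} violates it as soon as `ℓ log(1/p) > 3 log 3 +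
  4 log 2` (leading order in `p`), exactly the `K_{2,3}`/theta mechanism that refuted the SAW analogue
  (negatives index: stmt-CriticalPhenomena-8261) — convexity of the box is load-bearing.
* STUB 2 `stub_boxConnTendstoTau` (FOLKLORE, M): `P_p(x ↔ y in Λ_L) → τ_p(x,y)` as `L → ∞`, for all
  `x, y` (continuity of `P_p` along the increasing union `{x ↔ y} = ⋃_L {x ↔ y in Λ_L}`; Grimmett 1999
  §8.3 p. 203). The base-point-`0` case is in the tree
  (`Literature.Barriers.CriticalPhenomena.tendsto_real_openConnIn_box_tau`); the general case is the same
  proof with `openConnIn_iUnion_of_monotone` / `tendsto_measure_openConnIn_iUnion`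
  (IkhlefPonsaingFirstPassageProofs) and `iUnion_coe_box`.

Composition (kernel-checked, no `sorry` outside the stubs): `LogConnNegType_of :
stub_cubeLogConnNegType → stub_boxConnTendstoTau → LogConnNegType`. Given `p, x₁…xₙ, c` with `∑ c = 0`:
eventually in `L` all `x_i ∈ Λ_L` (`iUnion_coe_box`, `box_mono`), so STUB 1 gives
`0 ≤ ∑ c_i c_j log P_p(x_i ↔ x_j in Λ_L)`; and `log P_p(x_i ↔ x_j in Λ_L) → log τ_p(x_i,x_j)` termwise —
if `τ_p(x_i,x_j) = 0` every finite-volume probability is `0` too (`{x ↔ y in Λ} ⊆ {x ↔ y}`, proved here)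
and both sides are `Real.log 0`, otherwise `Real.log` is continuous at `τ ≠ 0` and STUB 2 applies; pass to
the limit in the finite double sum (`ge_of_tendsto`). No positivity of `τ`, no case split on `p`.

Also proved here (honest-piece / wiring checks): `cubeLogConnNegType_iff_isNegDefKernel` places STUB 1 in
the language of `Literature.Analysis.Matrix.IsNegDefKernel` (so Schoenberg's theorem
`Schoenberg1938_negDef_iff_exp_posDef_holds`, PROVED in the tree, turns it into "every Hadamard power
`[P_p(x ↔ y in Λ_L)^t]`, `t > 0`, is positive semidefinite" for refuters' Gram tests);
`cubeLogConnNegType_of_cuboid` derives STUB 1 from the route's support item `CuboidLogConnNegType`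
(stmt-2170) plus translation invariance of finite-volume connectivities (so 2170 closes STUB 1);
`real_openConnIn_le_tau` (`P_p(x ↔ y in S) ≤ τ_p(x,y)`).

DISPROOF USED: none exists for this crux (`ledger crux ls stmt-CriticalPhenomena-2166`: no workfiles, no
`Disproof.lean`, no landed Negative lemma, 2026-08-17). Negatives index (11 entries): the only related
entry is stmt-8261 (SAW confined-kernel infinite divisibility on ARBITRARY finite `Λ ⊂ ℤ²`, refuted on a
theta domain) — honoured by restricting STUB 1 to cubes. Neither stub is cheaply the crux or the conjunct
(BC3 probes `stub → LogConnNegType`, `stub → PercolationContinuityZ3` by `exact? | simpa | aesop` all FAIL,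
see `Lines/birth.md`).
-/

noncomputable section

namespace Summit.CriticalPhenomena.PercolationContinuityZ3.Cruxes.LogConnNegType.Birth

open Filter Topology MeasureTheory
open Literature.Probability.Percolation Literature.Probability.LatticeModels Literature.Analysis.Matrix
open Summit.CriticalPhenomena.PercolationContinuityZ3.Theses.PercLevyKhintchine (LogConnNegType CuboidLogConnNegType)

/-! ## The two stub statements -/

/-- STUB 1 statement: finite-volume (free b.c.) form of (ID) on the centred cubes `Λ_L = box 3 L`:
for sites `x_i ∈ Λ_L` and weights with `∑ c = 0`, `0 ≤ ∑ c_i c_j log P_p(x_i ↔ x_j in Λ_L)`. -/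
def CubeLogConnNegType : Prop :=
  ∀ (p : unitInterval) (L n : ℕ) (x : Fin n → Site 3) (c : Fin n → ℝ),
    (∀ i, x i ∈ box 3 L) → ∑ i, c i = 0 →
      0 ≤ ∑ i, ∑ j, c i * c j *
        Real.log ((bondPercolation (zdGraph 3) p).real (openConnIn (↑(box 3 L) : Set (Site 3)) (x i) (x j)))

/-- STUB 2 statement: finite-volume exhaustion of the two-point function, `P_p(x ↔ y in Λ_L) → τ_p(x,y)`. -/
def BoxConnTendstoTau : Prop :=
  ∀ (p : unitInterval) (x y : Site 3),
    Tendsto (fun L : ℕ => (bondPercolation (zdGraph 3) p).real (openConnIn (↑(box 3 L) : Set (Site 3)) x y))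
      atTop (𝓝 (tau 3 p x y))

/-! ## Registered stubs -/

/-- **STUB 1 `cubeLogConnNegType`** (OPEN — LOAD-BEARING): (ID) in finite volume with free boundary
conditions on every centred cube `Λ_L = {−L,…,L}³`: for `x_1,…,x_n ∈ Λ_L` and real `c` with `∑ c_i = 0`,
`∑_{i,j} c_i c_j log P_p(x_i ↔ x_j in Λ_L) ≥ 0`. Each instance is a finite exact computation (the kernel
entries are polynomials in `p`); it is the cube case of support item stmt-CriticalPhenomena-2170 after a
translation. Why it might fail where the crux holds: boundary entropy pockets (the free boundary removes
alternative paths); why it is not stated for arbitrary finite `Λ`: theta-shaped `Λ` violate it at small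
`p` (docstring of this file; negatives index stmt-8261). -/
theorem stub_cubeLogConnNegType : ∀ (p : unitInterval) (L n : ℕ) (x : Fin n → Literature.Probability.LatticeModels.Site 3) (c : Fin n → ℝ), (∀ i, x i ∈ Literature.Probability.LatticeModels.box 3 L) → ∑ i, c i = 0 → 0 ≤ ∑ i, ∑ j, c i * c j * Real.log ((Literature.Probability.Percolation.bondPercolation (Literature.Probability.LatticeModels.zdGraph 3) p).real (Literature.Probability.Percolation.openConnIn (↑(Literature.Probability.LatticeModels.box 3 L) : Set (Literature.Probability.LatticeModels.Site 3)) (x i) (x j))) := by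
  sorry

/-- **STUB 2 `boxConnTendstoTau`** (FOLKLORE, M): for all `p` and all `x, y ∈ ℤ³`,
`P_p(x ↔ y in Λ_L) → τ_p(x, y)` as `L → ∞` (Grimmett 1999 §8.3, p. 203: `τ_p(x,y;B(n)) ↑ τ_p(x,y)`).
In the tree for base point `0` (`Literature.Barriers.CriticalPhenomena.tendsto_real_openConnIn_box_tau`);
general `x` by the same continuity-from-below argument (`openConnIn_iUnion_of_monotone`,
`tendsto_measure_openConnIn_iUnion`, `iUnion_coe_box`) or by translating. -/
theorem stub_boxConnTendstoTau : ∀ (p : unitInterval) (x y : Literature.Probability.LatticeModels.Site 3), Filter.Tendsto (fun L : ℕ => (Literature.Probability.Percolation.bondPercolation (Literature.Probability.LatticeModels.zdGraph 3) p).real (Literature.Probability.Percolation.openConnIn (↑(Literature.Probability.LatticeModels.box 3 L) : Set (Literature.Probability.LatticeModels.Site 3)) x y)) Filter.atTop (nhds (Literature.Probability.Percolation.tau 3 p x y)) := by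
  sorry

/-! ### Name-keyed aliases of the stub statements
`__Registered.stub_X` is statement `X` under the registered stub's short name, so that the native skeleton
audit (`#h21_check_skeleton`: hypotheses admissible iff registered obligations / declared stubs BY NAME)
accepts `LogConnNegType_of : __Registered.stub_… → … → LogConnNegType` (device of
`Cruxes/BGNOffTheFloor/Lines/birth.lean` and `Cruxes/TruncatedSusceptibilityFiniteOfTheta/Lines/birth.lean`). -/
namespace __Registered

/-- Alias of `CubeLogConnNegType` keyed by the registered stub name. -/
abbrev stub_cubeLogConnNegType : Prop := CubeLogConnNegType
/-- Alias of `BoxConnTendstoTau` keyed by the registered stub name. -/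
abbrev stub_boxConnTendstoTau : Prop := BoxConnTendstoTau

end __Registered

/-- The registered STUB 1 is literally the statement `CubeLogConnNegType`. -/
theorem cubeLogConnNegType_of_stub : CubeLogConnNegType := stub_cubeLogConnNegType

/-- The registered STUB 2 is literally the statement `BoxConnTendstoTau`. -/
theorem boxConnTendstoTau_of_stub : BoxConnTendstoTau := stub_boxConnTendstoTau

/-! ## Proved plumbing -/

/-- `{x ↔ y in S} ⊆ {x ↔ y}` (an open path inside `S` is an open path). -/
theorem openConnIn_subset_openConn' {V : Type*} (S : Set V) (x y : V) :
    (openConnIn S x y : Set (BondConfig V)) ⊆ openConn x y := by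
  rintro ω ⟨hx, hy, h⟩
  exact h.map (SimpleGraph.Embedding.induce S).toHom

/-- `P_p(x ↔ y in S) ≤ τ_p(x, y)`. -/
theorem real_openConnIn_le_tau (p : unitInterval) (S : Set (Site 3)) (x y : Site 3) :
    (bondPercolation (zdGraph 3) p).real (openConnIn S x y) ≤ tau 3 p x y := by
  rw [tau_def]
  exact measureReal_mono (openConnIn_subset_openConn' S x y)

/-- A finite family of sites lies in `Λ_L` for all large `L`. -/
theorem eventually_forall_mem_box {n : ℕ} (x : Fin n → Site 3) :
    ∀ᶠ L : ℕ in atTop, ∀ i, x i ∈ box 3 L := by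
  refine Filter.eventually_all.2 fun i => ?_
  have hx : x i ∈ ⋃ L : ℕ, ((box 3 L : Finset (Site 3)) : Set (Site 3)) := by
    rw [iUnion_coe_box]; exact Set.mem_univ _
  obtain ⟨L₀, hL₀⟩ := Set.mem_iUnion.1 hx
  exact Filter.eventually_atTop.2 ⟨L₀, fun L hL => box_mono 3 hL hL₀⟩

/-- Termwise limit of the connectivity LOGARITHM along the cube exhaustion, from STUB 2 — with no
positivity needed: if `τ_p(x,y) = 0` every finite-volume probability vanishes too and both sides are
`Real.log 0`; otherwise `Real.log` is continuous at `τ_p(x,y) ≠ 0`. -/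
theorem tendsto_log_boxConn (hlim : BoxConnTendstoTau) (p : unitInterval) (x y : Site 3) :
    Tendsto (fun L : ℕ => Real.log ((bondPercolation (zdGraph 3) p).real (openConnIn (↑(box 3 L) : Set (Site 3)) x y)))
      atTop (𝓝 (Real.log (tau 3 p x y))) := by
  by_cases hτ : tau 3 p x y = 0
  · have hP : ∀ L : ℕ, (bondPercolation (zdGraph 3) p).real (openConnIn (↑(box 3 L) : Set (Site 3)) x y) = 0 :=
      fun L => le_antisymm ((real_openConnIn_le_tau p _ x y).trans hτ.le) measureReal_nonneg
    simp only [hP, hτ]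
    exact tendsto_const_nhds
  · exact (Real.continuousAt_log hτ).tendsto.comp (hlim p x y)

/-- The finite double sum of connectivity logarithms converges along the cube exhaustion (STUB 2). -/
theorem tendsto_sum_log_boxConn (hlim : BoxConnTendstoTau) (p : unitInterval) {n : ℕ}
    (x : Fin n → Site 3) (c : Fin n → ℝ) :
    Tendsto (fun L : ℕ => ∑ i, ∑ j, c i * c j *
        Real.log ((bondPercolation (zdGraph 3) p).real (openConnIn (↑(box 3 L) : Set (Site 3)) (x i) (x j))))
      atTop (𝓝 (∑ i, ∑ j, c i * c j * Real.log (tau 3 p (x i) (x j)))) :=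
  tendsto_finsetSum _ fun i _ => tendsto_finsetSum _ fun j _ =>
    (tendsto_log_boxConn hlim p (x i) (x j)).const_mul (c i * c j)

/-! ## The composition, by name -/

/-- **`LogConnNegType_of`**: the two registered stubs imply the crux
`Summit.CriticalPhenomena.PercolationContinuityZ3.Theses.PercLevyKhintchine.LogConnNegType`
(kernel-checked; no `sorry` outside the stubs): finite-volume negative type on the cubes `Λ_L` (STUB 1)
passes to the limit `L → ∞` termwise (STUB 2 through `tendsto_log_boxConn`) in the finite double sum. -/
theorem LogConnNegType_of (hcube : __Registered.stub_cubeLogConnNegType)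
    (hlim : __Registered.stub_boxConnTendstoTau) :
    Summit.CriticalPhenomena.PercolationContinuityZ3.Theses.PercLevyKhintchine.LogConnNegType := by
  intro p n x c hc
  have hev : ∀ᶠ L : ℕ in atTop, (0 : ℝ) ≤ ∑ i, ∑ j, c i * c j *
      Real.log ((bondPercolation (zdGraph 3) p).real (openConnIn (↑(box 3 L) : Set (Site 3)) (x i) (x j))) :=
    (eventually_forall_mem_box x).mono fun L hL => hcube p L n x c hL hc
  exact ge_of_tendsto (tendsto_sum_log_boxConn hlim p x c) hev

/-- Wiring check: the registered stubs feed `LogConnNegType_of` as stated. -/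
example : Summit.CriticalPhenomena.PercolationContinuityZ3.Theses.PercLevyKhintchine.LogConnNegType :=
  LogConnNegType_of stub_cubeLogConnNegType stub_boxConnTendstoTau

/-! ## Honest-piece checks (proved) -/

/-- STUB 1 in kernel language: for fixed `p, L` it says exactly that
`(x, y) ↦ −log P_p(x ↔ y in Λ_L)` is a negative definite kernel on `Λ_L` in the sense of
Berg–Christensen–Ressel (`Literature.Analysis.Matrix.IsNegDefKernel`, symmetric + `∑ c = 0 ⇒ form ≤ 0`),
GIVEN the (true, folklore) symmetry `P_p(x ↔ y in Λ) = P_p(y ↔ x in Λ)`. With Schoenberg's theorem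
(`Schoenberg1938_negDef_iff_exp_posDef_holds`, proved in the tree) this is the refuters' Gram test:
every Hadamard power `[P_p(x ↔ y in Λ_L)^t]_{x,y ∈ Λ_L}`, `t > 0`, positive semidefinite. -/
theorem cubeLogConnNegType_iff_isNegDefKernel
    (hsymm : ∀ (p : unitInterval) (L : ℕ) (x y : Site 3),
      (bondPercolation (zdGraph 3) p).real (openConnIn (↑(box 3 L) : Set (Site 3)) x y) =
        (bondPercolation (zdGraph 3) p).real (openConnIn (↑(box 3 L) : Set (Site 3)) y x)) :
    CubeLogConnNegType ↔ ∀ (p : unitInterval) (L : ℕ),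
      IsNegDefKernel fun x y : ↥(box 3 L) =>
        -Real.log ((bondPercolation (zdGraph 3) p).real (openConnIn (↑(box 3 L) : Set (Site 3)) x y)) := by
  constructor
  · intro h p L
    refine ⟨fun x y => congrArg (fun r : ℝ => -Real.log r) (hsymm p L x y), fun n x c hc => ?_⟩
    have h' := h p L n (fun i => (x i : Site 3)) c (fun i => (x i).2) hc
    have key : ∑ j, ∑ k, c j * c k *
        -Real.log ((bondPercolation (zdGraph 3) p).real (openConnIn (↑(box 3 L) : Set (Site 3)) (x j) (x k))) =
        -(∑ j, ∑ k, c j * c k *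
          Real.log ((bondPercolation (zdGraph 3) p).real (openConnIn (↑(box 3 L) : Set (Site 3)) (x j) (x k)))) := by
      simp only [mul_neg, Finset.sum_neg_distrib]
    rw [key]
    linarith
  · intro h p L n x c hmem hc
    have h' := (h p L).2 n (fun i => ⟨x i, hmem i⟩) c hc
    have key : ∑ j, ∑ k, c j * c k *
        -Real.log ((bondPercolation (zdGraph 3) p).real (openConnIn (↑(box 3 L) : Set (Site 3)) (x j) (x k))) =
        -(∑ j, ∑ k, c j * c k *
          Real.log ((bondPercolation (zdGraph 3) p).real (openConnIn (↑(box 3 L) : Set (Site 3)) (x j) (x k)))) := by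
      simp only [mul_neg, Finset.sum_neg_distrib]
    have h'' : ∑ j, ∑ k, c j * c k *
        -Real.log ((bondPercolation (zdGraph 3) p).real (openConnIn (↑(box 3 L) : Set (Site 3)) (x j) (x k))) ≤ 0 := h'
    rw [key] at h''
    linarith

/-- STUB 1 from the route's support item `CuboidLogConnNegType` (stmt-CriticalPhenomena-2170, cuboids
`[0,a₁]×[0,a₂]×[0,a₃]`) and the folklore translation invariance of finite-volume connectivities
(hypothesis `hshift`; Grimmett 1999 §1.6 — in the tree for `τ_p` as `tau_add_right`; the finite-volume form
follows the same way from `bondPercolation_real_preimage_shift` and `relabel_mem_openConnIn`): translate the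
centred cube `Λ_L` by `(L,L,L)` onto `[0,2L]³`. So closing item 2170 (+ `hshift`) closes STUB 1; the line
itself does not need the translation. -/
theorem cubeLogConnNegType_of_cuboid (h2170 : CuboidLogConnNegType)
    (hshift : ∀ (p : unitInterval) (lo hi v x y : Site 3),
      (bondPercolation (zdGraph 3) p).real
          (openConnIn (↑(Finset.Icc (lo + v) (hi + v)) : Set (Site 3)) (x + v) (y + v)) =
        (bondPercolation (zdGraph 3) p).real (openConnIn (↑(Finset.Icc lo hi) : Set (Site 3)) x y)) :
    CubeLogConnNegType := by
  intro p L n x c hmem hc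
  have hlo : -(L : Site 3) + (L : Site 3) = 0 := neg_add_cancel _
  have hhi : (L : Site 3) + (L : Site 3) = ![((2 * L : ℕ) : ℤ), ((2 * L : ℕ) : ℤ), ((2 * L : ℕ) : ℤ)] := by
    funext k
    fin_cases k <;> simp [two_mul]
  have hmem' : ∀ i, x i + (L : Site 3) ∈
      Finset.Icc (0 : Site 3) ![((2 * L : ℕ) : ℤ), ((2 * L : ℕ) : ℤ), ((2 * L : ℕ) : ℤ)] := by
    intro i
    have hx : x i ∈ Finset.Icc (-(L : Site 3)) (L : Site 3) := box_eq_Icc 3 L ▸ hmem i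
    rw [Finset.mem_Icc] at hx
    rw [← hhi, ← hlo, Finset.mem_Icc]
    obtain ⟨h1, h2⟩ := hx
    exact ⟨fun k => by have := h1 k; simp only [Pi.add_apply, Pi.neg_apply, Pi.natCast_apply] at this ⊢; omega,
      fun k => by have := h2 k; simp only [Pi.add_apply, Pi.natCast_apply] at this ⊢; omega⟩
  have h0 := h2170 p (2 * L) (2 * L) (2 * L) n (fun i => x i + (L : Site 3)) c hmem' hc
  have hterm : ∀ a b : Site 3,
      (bondPercolation (zdGraph 3) p).real (openConnIn
          (↑(Finset.Icc (0 : Site 3) ![((2 * L : ℕ) : ℤ), ((2 * L : ℕ) : ℤ), ((2 * L : ℕ) : ℤ)]) : Set (Site 3))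
          (a + (L : Site 3)) (b + (L : Site 3))) =
        (bondPercolation (zdGraph 3) p).real (openConnIn (↑(box 3 L) : Set (Site 3)) a b) := by
    intro a b
    rw [← hhi, ← hlo, hshift, ← box_eq_Icc]
  simpa only [hterm] using h0

end Summit.CriticalPhenomena.PercolationContinuityZ3.Cruxes.LogConnNegType.Birth

end
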